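import Literature.AnabelianGeometry.EtaleTheta.LogDivisorModelZTowerRays
import Literature.AnabelianGeometry.EtaleTheta.BiKummerThm44HypOfGaloisCoveringZTower
import Literature.AlgebraicGeometry.Frobenioids.ArithmeticFrobenioidNonDilating
import Literature.AlgebraicGeometry.Frobenioids.PerfectionPrimes
import Literature.AlgebraicGeometry.Frobenioids.MonoidTransport
import HarnessLib

/-!
# [EtTh] Thm. 4.4: `Thm44Hyp` INHABITED at the ℤ-tower data for EVERY character `φ : Π^tp_X → ℤ` — `Φ` is NON-DILATING along
# every endomorphism because a deck transformation either acts trivially or carries a PRIMARY RAY off itself (class (b) NV)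

S. Mochizuki, *The étale theta function …*, Publ. RIMS **45** (2009) [MochizukiEtTh2009], Rmk. 3.3.1 p.73, Def. 3.6 (ii) p.76–77,
Def. 4.1 p.86–87, Thm. 4.4 p.93–95 [cite: MochizukiEtTh2009, Thm 4.4 p.93]; [FrdI] §0 p.12 (primary, `≼`), Def. 1.1 (i) p.19
(«non-dilating»: `α^char = id` as soon as `α^char(a) ≼ a` for every primary `a`).

abc-iut cell, layer L2 [EtTh], seat abc-iut-w5-d179 (gen 6), L2-lead row R505 sequel 2/2 («Thm44Hyp at EVERY character»).  Part B
(`BiKummerThm44HypOfGaloisCoveringZTower.lean`, p464833) inhabited `Thm44Hyp` at the TRIVIAL character only, where every pull-back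
is the identity.  THIS FILE removes that restriction:
* **`TemperedFrobenioid.DiagonalBase.isNonDilating_pull_of_dichotomy`** (ENGINE level, any diagonal base data `P`): if along an
  endomorphism `φ` of the base the pull-back `Φ₀(F φ)` is EITHER the identity OR carries some PRIMARY `p ∈ Φ₀(F A)` off itself
  (`¬ Φ₀(F φ)(p) ≼ p`), then `Φ(φ) : Φ(A) → Φ(A)` is non-dilating ([FrdI] Def. 1.1 (i)) — via the tree's reduction to primary
  elements of a sharp monoid (`isNonDilating_of_forall_isPrimary`), transporting `p` to the primary `ι(p) ∈ Φ(A) ≅ Φ₀(F A)^pf`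
  (`Perfection.isPrimary_mk_iff`, `IsPrimary.map_mulEquiv`) and `≼` back (`precsim_map_iff`, `Perfection.of_precsim_of_iff`);
* **`ZTowerTempered.isNonDilating X φ R S A α`** — for EVERY `X`, `φ`, connected tempered covering `A` and endomorphism `α`: the
  ℤ-tower's `Φ` is non-dilating along `α`, by the dichotomy `ZTower.phiZeroPull_dichotomy` (`LogDivisorModelZTowerRays`): a deck
  transformation `g₀` of `Π/H` translates the coordinates by `φ g₀`; either `φ g₀ ∈ φ(H)` (identity) or the primary ray
  `e_{(s₀, F_0)}` moves to `e_{(s₀, F_{φ g₀})} ⋠ e_{(s₀, F_0)}`;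
* **`ZTowerTempered.thm44HypOf X φ R S NH M : Thm44Hyp (setting X φ …) (setting X φ …)`** for EVERY `φ` — and this lineage's
  Thm. 4.4 closers fired BY NAME there: `thm44_i_of`, `thm44_trivNH_of` ((i) ∧ (ii) ∧ (iii) ∧ N-th roots), `thm44_rootsNH_of`.
So the §4 hypothesis record holds at a tempered Frobenioid over `B^temp(Π^tp_X)⁰` whose `Φ₀(Π/H) ≅ ∏_{ℤ/φ(H)} ℤ_{≥0}` has the
print-shaped rank `[ℤ : φ(H)]` (one component over `X` for `φ` onto, infinitely many over `H ≤ ker φ`) and whose `Φ^{bs-fld}` is a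
PROPER submonoid wherever the rank exceeds one.  Class (b): 1 def (`thm44HypOf`) + 3 abbrevs; no Prop fact, no instance, no sorry.
HONEST FRAMING: combinatorial model of the divisor/Galois skeleton; `φ` a parameter; interface records as before; nothing here
bears on [IUTchIII] Cor. 3.12; typed ≠ proved.
-/

noncomputable section

namespace Literature.AnabelianGeometry.EtaleTheta

open CategoryTheory Opposite Function Literature.AlgebraicGeometry.Frobenioids
  Literature.AnabelianGeometry.SemiGraphs LogDivisorModel LogDivisorModel.GaloisAction

universe u₀ v₀ u v

/-! ## §1 Engine level: non-dilating from the dichotomy «identity, or a primary element carried off itself» -/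

namespace TemperedFrobenioid.DiagonalBase

variable {D₀ : Type u₀} [Category.{v₀} D₀] {dm : DivisorMonoids.{u₀, v₀, 0} D₀}
  (hpf : ∀ Y : D₀ᵒᵖ, IsPerfFactorialCof (dm.Φ₀.obj Y)) {D : Type u} [Category.{v} D] (P : DiagonalBase dm D)

/-- The pull-back of `Φ` on the image of `Φ₀`: `Φ(φ)(ι(p)) = ι(Φ₀(F φ)(p))`. [cite: MochizukiFrdI2008, Prop. 5.3 p.103] -/
theorem Φsub_pull_toRealification_of {A : Dᵒᵖ} (φ : A ⟶ A) (p : dm.Φ₀.obj (op (P.F.obj A.unop))) :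
    ((P.Φsub hpf).pull φ ⟨(hpf (op (P.F.obj A.unop))).weak.toRealification (Perfection.of _ p), ⟨_, rfl⟩⟩).1 =
      (hpf (op (P.F.obj A.unop))).weak.toRealification (Perfection.of _ ((dm.Φ₀.map (P.F.map φ.unop).op).hom p)) := by
  rw [SubMonoidOn.coe_pull]
  exact rlfMapWeak_toRealification_of dm.Φ₀ hpf (P.F.map φ.unop).op p

/-- **Non-dilating from the dichotomy** ([FrdI] Def. 1.1 (i)): if the pull-back `Φ₀(F φ)` is either the identity of `Φ₀(F A)` or
carries some PRIMARY `p` off itself (`¬ Φ₀(F φ)(p) ≼ p`), then `Φ(φ)` is non-dilating — the dilation premise «`Φ(φ)^char(a) ≼ a`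
for every primary `a`» fails at `a = ι(p)`, primary in `Φ(A) ≅ Φ₀(F A)^pf`. [cite: MochizukiFrdI2008, Def. 1.1 (i) p.19] -/
theorem isNonDilating_pull_of_dichotomy {A : Dᵒᵖ} (φ : A ⟶ A)
    (h : (∀ m : dm.Φ₀.obj (op (P.F.obj A.unop)), (dm.Φ₀.map (P.F.map φ.unop).op).hom m = m) ∨
      ∃ p : dm.Φ₀.obj (op (P.F.obj A.unop)), IsPrimary p ∧ ¬ Precsim ((dm.Φ₀.map (P.F.map φ.unop).op).hom p) p) :
    IsNonDilating ((P.Φsub hpf).pull φ) := by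
  refine isNonDilating_of_forall_isPrimary (M := (P.Φsub hpf).carrier A)
    (PfImageWeak.isDivisorial_mrange_toRealification (hpf _)).isSharp _ fun H => ?_
  rcases h with hid | ⟨p, hp, hnot⟩
  · exact MonoidHom.ext fun x => P.Φsub_pull_apply_of_trivial hpf φ hid x
  · exfalso
    have hM := hpf (op (P.F.obj A.unop))
    let e : Perfection (dm.Φ₀.obj (op (P.F.obj A.unop))) ≃* (P.Φsub hpf).carrier A :=
      MulEquiv.ofBijective hM.weak.toRealification.mrangeRestrict
        (PfImageWeak.mrangeRestrict_toRealification_bijective hM.weak)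
    have he : ∀ q : dm.Φ₀.obj (op (P.F.obj A.unop)),
        e (Perfection.of _ q) = ⟨hM.weak.toRealification (Perfection.of _ q), ⟨_, rfl⟩⟩ := fun _ => rfl
    have hprim : IsPrimary (e (Perfection.of _ p)) :=
      ((Perfection.isPrimary_mk_iff hM.weak.isDivisorial.isSharp).2 hp).map_mulEquiv e
    have h1 := H _ hprim
    have hpull : (P.Φsub hpf).pull φ (e (Perfection.of _ p)) =
        e (Perfection.of _ ((dm.Φ₀.map (P.F.map φ.unop).op).hom p)) := by
      rw [he, he]
      exact Subtype.ext (P.Φsub_pull_toRealification_of hpf φ p)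
    have h2 : Precsim (e (Perfection.of _ ((dm.Φ₀.map (P.F.map φ.unop).op).hom p))) (e (Perfection.of _ p)) := by
      rw [← hpull]
      exact h1
    exact hnot (Perfection.of_precsim_of_iff.1 ((precsim_map_iff e).1 h2))

end TemperedFrobenioid.DiagonalBase

/-! ## §2 The ℤ-tower: `Φ` non-dilating along every endomorphism, `Thm44Hyp` for every character -/

namespace ZTowerTempered

variable {K : Type} [Field K] (X : SemiGraphs.TemperedArithmeticGroup.{0} K) (φ : X.Pi →* Multiplicative ℤ)
  (R S : ((ConnectedPart (BTemp X.Pi))ᵒᵖ ⥤ CommMonCat.{0}) → Prop)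

/-- **`Φ` of the ℤ-tower tempered Frobenioid is NON-DILATING along EVERY endomorphism of every connected tempered covering**,
for every character `φ` ([FrdI] Def. 1.1 (i)): a deck transformation translating the chain by `φ g₀` either acts as the
identity on `Φ₀(Π/H)` (`φ g₀ ∈ φ(H)`) or carries the primary ray `e_{(s₀, F_0)}` off itself.
[cite: MochizukiFrdI2008, Def. 1.1 (i) p.19] -/
theorem isNonDilating (A : (ConnectedPart (BTemp X.Pi))ᵒᵖ) (α : A ⟶ A) :
    treeMonoidVocabWeak.{0}.IsNonDilating ((temperedFrobenioid X φ R S).Φ.carrier A) ((temperedFrobenioid X φ R S).Φ.pull α) :=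
  TemperedFrobenioid.DiagonalBase.isNonDilating_pull_of_dichotomy (hpf X φ) (diagonalBase X φ) α
    (ZTower.phiZeroPull_dichotomy φ (isConnectedGSet_gset X A.unop) _)

variable (NH : Subgroup (Field.absoluteGaloisGroup K) → (temperedFrobenioid X φ R S).category → ℕ+ → Prop)
  (M : OpenNormalSubgroup X.Pi)

/-- **`Thm44Hyp` INHABITED at the ℤ-tower data for EVERY character `φ`** over `B^temp(Π^tp_X)⁰`: the identity self-equivalence
(`Φ` non-dilating by `isNonDilating`; `baseShape` with `𝒟 := Π/Π`; `H_⊙` open; `comm` by unitors). [cite: MochizukiEtTh2009, Thm 4.4 p.93] -/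
def thm44HypOf : BiKummerSetting.Thm44Hyp (setting X φ R S NH M) (setting X φ R S NH M) where
  isNonDilating₁ A α := isNonDilating X φ R S A α
  isNonDilating₂ A α := isNonDilating X φ R S A α
  baseShape₁ := baseShape X φ R S
  baseShape₂ := baseShape X φ R S
  isOpen_Hodot₁ := BiKummerSetting.isOpen_Hodot_mkOfConnectedTemperoid X _ _ _ NH _ _ _
  isOpen_Hodot₂ := BiKummerSetting.isOpen_Hodot_mkOfConnectedTemperoid X _ _ _ NH _ _ _
  Ψ := CategoryTheory.Equivalence.refl
  Ψbs := CategoryTheory.Equivalence.refl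
  comm := (setting X φ R S NH M).base.rightUnitor ≪≫ (setting X φ R S NH M).base.leftUnitor.symm
  mapsAodot := ⟨Iso.refl _⟩

/-- **Non-vacuity of `Thm44Hyp` at the ℤ-tower data, every character.** [cite: MochizukiEtTh2009, Thm 4.4 p.93] -/
theorem nonempty_thm44HypOf : Nonempty (BiKummerSetting.Thm44Hyp (setting X φ R S NH M) (setting X φ R S NH M)) :=
  ⟨thm44HypOf X φ R S NH M⟩

/-- **[EtTh] Thm. 4.4 (i) FIRES at the ℤ-tower data, every character and every `(N, H)`-slot** (this lineage's
`thm44_i_mkOfConnectedTemperoid_of_baseInj_treeVocabWeak` ⇐ {hBD₁, hBD₂}). [cite: MochizukiEtTh2009, Thm 4.4 (i) p.94] -/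
theorem thm44_i_of : BiKummerSetting.Thm44_i (thm44HypOf X φ R S NH M) :=
  (thm44HypOf X φ R S NH M).thm44_i_mkOfConnectedTemperoid_of_baseInj_treeVocabWeak _ _ _ NH _ _ _ _ _ _ NH _ _ _
    (fun α => hBD X φ R S α) fun α => hBD X φ R S α

/-- T44-L03 at the identity (from `hBD`). [cite: MochizukiEtTh2009, Thm 4.4 p.95] -/
theorem preservesFrobeniusStructure_of : (thm44HypOf X φ R S NH M).PreservesFrobeniusStructure :=
  (thm44HypOf X φ R S NH M).preservesFrobeniusStructure_mkOfConnectedTemperoid_of_baseInj_treeVocabWeak _ _ _ NH _ _ _ _ _ _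
    NH _ _ _ (fun α => hBD X φ R S α) fun α => hBD X φ R S α

/-- The `ψ`-slot of Thm. 4.4 (ii)(iii): this lineage's `psiModel` at the identity. [cite: MochizukiEtTh2009, Thm 4.4 p.94] -/
abbrev ψOf (A : (setting X φ R S NH M).C) :
    (setting X φ R S NH M).biratUnits A ≃* (setting X φ R S NH M).biratUnits ((thm44HypOf X φ R S NH M).Ψ.functor.obj A) :=
  (thm44HypOf X φ R S NH M).psiModel (isFrobenioid_temperedFrobenioid X φ R S) (isFrobenioid_temperedFrobenioid X φ R S)
    (preservesFrobeniusStructure_of X φ R S NH M) A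

end ZTowerTempered

namespace ZTowerTempered

variable {K : Type} [Field K] (X : SemiGraphs.TemperedArithmeticGroup.{0} K) (φ : X.Pi →* Multiplicative ℤ)
  (R S : ((ConnectedPart (BTemp X.Pi))ᵒᵖ ⥤ CommMonCat.{0}) → Prop) (M : OpenNormalSubgroup X.Pi)

/-- The TRIVIAL `(N, H)`-slot (`True`). [cite: MochizukiEtTh2009, Def 4.1 p.87] -/
abbrev trivNHOf : Subgroup (Field.absoluteGaloisGroup K) → (temperedFrobenioid X φ R S).category → ℕ+ → Prop :=
  fun _ _ _ => True

/-- T44-L15b at the identity with the trivial `(N, H)`-slot: tautological. [cite: MochizukiEtTh2009, Thm 4.4 p.95] -/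
theorem preservesNHSaturatedBsFld_trivNH_of : (thm44HypOf X φ R S (trivNHOf X φ R S) M).PreservesNHSaturatedBsFld :=
  fun _ _ _ _ _ => Iff.rfl

/-- **[EtTh] Thm. 4.4 (i) ∧ (ii) ∧ (iii)-saturation ∧ N-th roots FIRE at the ℤ-tower data, every character** (trivial
`(N, H)`-slot; this lineage's `thm44_mkOfConnectedTemperoid_of_baseInj_treeVocabWeak'` ⇐ {hBD₁, hBD₂, T44-L15b}, all PROVED here).
[cite: MochizukiEtTh2009, Thm 4.4 p.94] -/
theorem thm44_trivNH_of :
    BiKummerSetting.Thm44_i (thm44HypOf X φ R S (trivNHOf X φ R S) M) ∧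
      BiKummerSetting.Thm44_ii (thm44HypOf X φ R S (trivNHOf X φ R S) M) (ψOf X φ R S (trivNHOf X φ R S) M) ∧
      BiKummerSetting.Thm44_iii (thm44HypOf X φ R S (trivNHOf X φ R S) M) (ψOf X φ R S (trivNHOf X φ R S) M) ∧
      (thm44HypOf X φ R S (trivNHOf X φ R S) M).PreservesNthRoots (ψOf X φ R S (trivNHOf X φ R S) M)
        (fun φ' f => (temperedFrobenioid X φ R S).pullFracModel φ' f)
        fun φ' f => (temperedFrobenioid X φ R S).pullFracModel φ' f :=
  (thm44HypOf X φ R S (trivNHOf X φ R S) M).thm44_mkOfConnectedTemperoid_of_baseInj_treeVocabWeak' _ _ _ _ _ _ _ _ _ _ _ _ _ _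
    (fun α => hBD X φ R S α) (fun α => hBD X φ R S α) (preservesNHSaturatedBsFld_trivNH_of X φ R S M)

/-- The ROOTS READING of the `(N, H)`-slot (abc-iut-w4-d044). [cite: MochizukiEtTh2009, Def 4.1 p.87] -/
abbrev rootsNHOf : Subgroup (Field.absoluteGaloisGroup K) → (temperedFrobenioid X φ R S).category → ℕ+ → Prop :=
  fun _ A N => ∀ (g : A.base ⟶ ((temperedFrobenioid X φ R S).connQuotZeroObj M).base)
    (x : (temperedFrobenioid X φ R S).ratFnFunctor.obj (op ((temperedFrobenioid X φ R S).connQuotZeroObj M).base)),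
    divB (temperedFrobenioid X φ R S).divisorMonoid (temperedFrobenioid X φ R S).ratFnFunctor
        (temperedFrobenioid X φ R S).divBNatTrans (op ((temperedFrobenioid X φ R S).connQuotZeroObj M).base) x = 1 →
      ∃ ζ : (temperedFrobenioid X φ R S).ratFnFunctor.obj (op A.base),
        ζ ^ (N : ℕ) = pull (temperedFrobenioid X φ R S).ratFnFunctor g x

/-- **[EtTh] Thm. 4.4 (i) ∧ (ii) ∧ (iii)-saturation ∧ N-th roots FIRE at the ℤ-tower data, every character, AT THE ROOTS READING**
of the `(N, H_⊙^{bs-fld})`-slot (⇐ {hBD₁, hBD₂}; T44-L15b by abc-iut-w4-d044's `preservesNHSaturatedBsFld_rootsReading`).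
[cite: MochizukiEtTh2009, Thm 4.4 p.94] -/
theorem thm44_rootsNH_of :
    BiKummerSetting.Thm44_i (thm44HypOf X φ R S (rootsNHOf X φ R S M) M) ∧
      BiKummerSetting.Thm44_ii (thm44HypOf X φ R S (rootsNHOf X φ R S M) M) (ψOf X φ R S (rootsNHOf X φ R S M) M) ∧
      BiKummerSetting.Thm44_iii (thm44HypOf X φ R S (rootsNHOf X φ R S M) M) (ψOf X φ R S (rootsNHOf X φ R S M) M) ∧
      (thm44HypOf X φ R S (rootsNHOf X φ R S M) M).PreservesNthRoots (ψOf X φ R S (rootsNHOf X φ R S M) M)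
        (fun φ' f => (temperedFrobenioid X φ R S).pullFracModel φ' f)
        fun φ' f => (temperedFrobenioid X φ R S).pullFracModel φ' f :=
  (thm44HypOf X φ R S (rootsNHOf X φ R S M) M).thm44_mkOfConnectedTemperoid_rootsReading_of_baseInj_treeVocabWeak
    (temperedFrobenioid X φ R S) rfl (hP X φ R S) ((temperedFrobenioid X φ R S).connQuotZeroObj M)
    ((temperedFrobenioid X φ R S).isFrobeniusTrivial_connQuotZeroObj M)
    ((temperedFrobenioid X φ R S).isGaloisObj_connQuotZeroObj_base M)
    (temperedFrobenioid X φ R S) rfl (hP X φ R S) ((temperedFrobenioid X φ R S).connQuotZeroObj M)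
    ((temperedFrobenioid X φ R S).isFrobeniusTrivial_connQuotZeroObj M)
    ((temperedFrobenioid X φ R S).isGaloisObj_connQuotZeroObj_base M)
    (isFrobenioid_temperedFrobenioid X φ R S) (isFrobenioid_temperedFrobenioid X φ R S)
    (preservesFrobeniusStructure_of X φ R S _ M) (fun α => hBD X φ R S α) fun α => hBD X φ R S α

end ZTowerTempered

end Literature.AnabelianGeometry.EtaleTheta

end
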